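import Literature.Topology.FourManifolds.LoopSurgeryHomotopySphereProofs
import Summits.SmoothPoincare4.SmoothPoincare4.Theorems.WeakReductionDescentWeakReductionReducesStubLoopNoDescentFromFiveAux1

/-!
# `stub_loopNoDescentFromFive` (L₅) at EVERY rung `g ≥ 5` ⇐ two cited facts ∧ one typed residue
(line `loop_dichotomy`, crux `WeakReductionDescent.WeakReductionReduces` = stmt-SmoothPoincare4-17908)

`helper_loopNoDescentFromFive_of_residue : F1 → F2 → H_res → L₅` (L₅ = the registered stub's
signature VERBATIM as conclusion), where

* F1 = `Literature.Topology.FourManifolds.msz_loopSurgery_homotopySphere_gk` (Meier–Schirmer–Zupan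
  2016 Thm. 1.2, arXiv numbering, for loop presentations of homotopy spheres: MSZ range ⇒ the
  presented homotopy sphere is `S⁴`) and F2 =
  `Literature.Topology.FourManifolds.gkTrisection_sum_eq_add_two_of_loopSurgery_homotopySphere`
  (`Σ kᵢ = g + 2`, i.e. `χ(X) = 0`, Gay–Kirby Remark 2 with `χ(X_ℓ) = χ(X) + 2`) are the two
  cited facts of `Literature/Topology/FourManifolds/LoopSurgeryHomotopySphere.lean` (the third,
  orientability of `X`, is now PROVED: `isOrientable_of_isCircleSurgery_four_holds`,
  `LoopSurgeryHomotopySphereProofs.lean`, and is consumed here, not assumed);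
* H_res — the typed RESIDUE of L₅ (a hypothesis, NOT a literature fact; open, SPC4-implied):
  for `g ≥ 5`, no ORIENTABLE loop partner `X` with a `(g'; k')`-GK-trisection of genus
  `4 ≤ g' < g` OUTSIDE the Meier–Schirmer–Zupan range (`k'ᵢ + 2 ≤ g'` for all `i`) and with
  `Σ k'ᵢ = g' + 2` presents, by surgery on a smoothly embedded loop, a smooth homotopy 4-sphere
  whose minimal GK-trisection genus is `g`.  Its first instance is the single type `(4; 2, 2, 2)`
  at `g = 5` (`…StubLoopNoDescentFromFiveAux1/2.lean`); at `g = 6` the types `(5; 3, 3, 1)`,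
  `(5; 3, 2, 2)` join, etc.

So, modulo MSZ16 and Euler-characteristic bookkeeping, L₅ is EXACTLY as open as H_res: the
composition `weakReductionReduces_of_pieces D L₃ (helper_loopNoDescentFromFive_of_residue hF1 hF2 hRes)`
of the line's skeleton type-checks with H_res in place of L₅.  Proof: `X` is compact and
connected (trisected) and orientable (proved fact F0 with Lee's theorem that homotopy 4-spheres
are orientable); F2 gives `Σ k' = g' + 2`; in the MSZ range F1 gives `M ≅ S⁴`, contradicting
minimality (`not_minimalGenus_of_diffeomorph_sphere`); outside it `g' ≥ 4` by arithmetic and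
H_res applies.  No definitions, no `sorry`.
-/

-- the registered namespace `Summit.SmoothPoincare4.SmoothPoincare4.…` repeats a component
set_option linter.dupNamespace false

open scoped Manifold ContDiff ContinuousMap Topology
open Set
open Literature.Topology.FourManifolds

namespace Summit.SmoothPoincare4.SmoothPoincare4.Theorems.WeakReductionReduces.LoopDichotomy

/-- **L₅ from MSZ16, `χ`-bookkeeping and the typed residue H_res (all rungs `g ≥ 5`).**
Hypotheses: (F1) `msz_loopSurgery_homotopySphere_gk`; (F2)
`gkTrisection_sum_eq_add_two_of_loopSurgery_homotopySphere`; (H_res) no orientable loop partner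
of genus `4 ≤ g' < g` outside the MSZ range (`∀ i, k'ᵢ + 2 ≤ g'`) with `Σ k'ᵢ = g' + 2` presents
a genus-`g`-minimal smooth homotopy 4-sphere, `g ≥ 5` (the honest open residue; NOT a literature
fact).  Conclusion: the registered stub `stub_loopNoDescentFromFive` verbatim.  Orientability of
the partner is the PROVED fact `isOrientable_of_isCircleSurgery_four_holds` (with
`isOrientable_of_homotopyEquiv_sphere_four_holds`); compactness and connectedness come from the
trisection; the MSZ branch contradicts minimality through Gay–Kirby's genus-`0` trisection of
`S⁴` (`not_minimalGenus_of_diffeomorph_sphere`).  Conditional on F1, F2 and H_res (D-0014).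
[cite: MeierSchirmerZupan2016, Thm. 1.2 (arXiv numbering)] [cite: GayKirby2016, Remark 2] -/
theorem helper_loopNoDescentFromFive_of_residue : Literature.Topology.FourManifolds.msz_loopSurgery_homotopySphere_gk → Literature.Topology.FourManifolds.gkTrisection_sum_eq_add_two_of_loopSurgery_homotopySphere → (∀ (M : Type) [TopologicalSpace M] [T2Space M] [SecondCountableTopology M] [ChartedSpace (EuclideanSpace ℝ (Fin 4)) M] [IsManifold (𝓡 4) ∞ M], (M ≃ₕ (Metric.sphere (0 : EuclideanSpace ℝ (Fin 5)) 1)) → ∀ (g : ℕ) (k : Fin 3 → ℕ) (T : Fin 3 → Set M), Literature.Topology.FourManifolds.IsGKTrisection M g k T → 5 ≤ g → (∀ (g'' : ℕ) (k'' : Fin 3 → ℕ) (T'' : Fin 3 → Set M), Literature.Topology.FourManifolds.IsGKTrisection M g'' k'' T'' → g ≤ g'') → ∀ (X : Type) [TopologicalSpace X] [T2Space X] [SecondCountableTopology X] [ChartedSpace (EuclideanSpace ℝ (Fin 4)) X] [IsManifold (𝓡 4) ∞ X], Literature.Topology.FourManifolds.IsOrientable (𝓡 4) X → ∀ (g' :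 ℕ) (k' : Fin 3 → ℕ) (T' : Fin 3 → Set X), 4 ≤ g' → g' < g → Literature.Topology.FourManifolds.IsGKTrisection X g' k' T' → k' 0 + k' 1 + k' 2 = g' + 2 → (∀ i, k' i + 2 ≤ g') → ∀ (ℓ : (Metric.sphere (0 : EuclideanSpace ℝ (Fin 2)) 1) → X), Manifold.IsSmoothEmbedding (𝓡 1) (𝓡 4) ∞ ℓ → ¬ Literature.Topology.FourManifolds.IsCircleSurgery (𝓡 4) (𝓡 4) X M ℓ) → ∀ (M : Type) [TopologicalSpace M] [T2Space M] [SecondCountableTopology M] [ChartedSpace (EuclideanSpace ℝ (Fin 4)) M] [IsManifold (𝓡 4) ∞ M], (M ≃ₕ (Metric.sphere (0 : EuclideanSpace ℝ (Fin 5)) 1)) → ∀ (g : ℕ) (k : Fin 3 → ℕ) (T : Fin 3 → Set M), Literature.Topology.FourManifolds.IsGKTrisection M g k T → 5 ≤ g → (∀ (g'' : ℕ) (k'' : Fin 3 → ℕ) (T'' : Fin 3 → Set M), Literature.Topology.FourManifolds.IsGKTrisection M g'' k'' T'' → g ≤ g'') → ∀ (X : Type) [TopologicalSpace X] [T2Space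 X] [SecondCountableTopology X] [ChartedSpace (EuclideanSpace ℝ (Fin 4)) X] [IsManifold (𝓡 4) ∞ X] (g' : ℕ) (k' : Fin 3 → ℕ) (T' : Fin 3 → Set X), g' < g → Literature.Topology.FourManifolds.IsGKTrisection X g' k' T' → ∀ (ℓ : (Metric.sphere (0 : EuclideanSpace ℝ (Fin 2)) 1) → X), Manifold.IsSmoothEmbedding (𝓡 1) (𝓡 4) ∞ ℓ → ¬ Literature.Topology.FourManifolds.IsCircleSurgery (𝓡 4) (𝓡 4) X M ℓ := by
  intro hF1 hF2 hRes M _ _ _ _ _ e g k T hT hg5 hmin X _ _ _ _ _ g' k' T' hlt hT' ℓ hℓ hsurg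
  -- the loop partner `X` is closed, connected, oriented
  haveI : CompactSpace X := hT'.compactSpace
  haveI : ConnectedSpace X := connectedSpace_of_isGKTrisection hT'
  have hMo : IsOrientable (𝓡 4) M := isOrientable_of_homotopyEquiv_sphere_four_holds M e
  have hXo : IsOrientable (𝓡 4) X := isOrientable_of_isCircleSurgery_four_holds X ℓ M hsurg hMo
  -- `χ(X) = 0`, i.e. `Σ k' = g' + 2`
  have hχ : k' 0 + k' 1 + k' 2 = g' + 2 := hF2 X hXo g' k' T' hT' ℓ hℓ M e hsurg
  by_cases hex : ∃ i, g' ≤ k' i + 1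
  · -- Meier–Schirmer–Zupan range: `M ≅ S⁴`, contradicting minimality
    obtain ⟨Φ⟩ := hF1 X hXo g' k' T' hT' hex ℓ hℓ M e hsurg
    exact Summit.SmoothPoincare4.SmoothPoincare4.Theorems.not_minimalGenus_of_diffeomorph_sphere Φ
      (by omega) hmin
  · -- outside the MSZ range: the residue
    push Not at hex
    have hout : ∀ i, k' i + 2 ≤ g' := fun i => by have := hex i; omega
    have h4 : 4 ≤ g' := by
      have h0 := hout 0; have h1 := hout 1; have h2 := hout 2
      omega
    exact hRes M e g k T hT hg5 hmin X hXo g' k' T' h4 hlt hT' hχ hout ℓ hℓ hsurg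

end Summit.SmoothPoincare4.SmoothPoincare4.Theorems.WeakReductionReduces.LoopDichotomy
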